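import Summits.BirchSwinnertonDyer.BirchSwinnertonDyer.Theorems.PrintCf2RubinValueTwoKatzMeasureJZeroReadingConjugacy
import Summits.BirchSwinnertonDyer.BirchSwinnertonDyer.Theorems.PrintCf2RubinValueTwoAvatarOnRayExact
import Literature.NumberTheory.EllipticCurves.DeShalit1987.LMeasureAvatarRigidity
import Literature.NumberTheory.EllipticCurves.DeShalit1987.RayClassTowerDiagonalSplit
import Literature.NumberTheory.EllipticCurves.EisensteinNumbers
import Literature.NumberTheory.LFunctions.GrossencharakterWeightOneNorm
import Literature.NumberTheory.PAdicHodge.UnramifiedCompletionReadingUnrIntegers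
import HarnessLib

/-!
# The SEAM of the `j = 0` lane, PART 1a — bookkeeping lemmas: the order of the modulus, the homogeneity of the class-lattice Eisenstein
# numbers, the primes above `2`, and the EXACT avatar on `Gal(K̄/K(𝔪))` in the cell-sum currency (`hχG` of H11)

Cell `bsd-print-cf2`, width seat `bsd-line-cf2-p1-w8` g13 (PART 1a of -w3 g31's `hseam♯_of_lane` split, 2026-08-30); `--supports` the crux
stmt-BirchSwinnertonDyer-20368 (helper, Theses-free).  THEOREMS ONLY; no `def`, no named fact, no `sorry`.  Consumed by
`…KatzMeasureJZeroSeamClassSumAtLevel.lean`.  Nothing here closes a crux; no summit statement is proved; BSD is not proved by any of this.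

* `le_count_modulusIdeal` — `ord_w 𝔪(T, e) ≥ e(w)` (the `hle` input of A2 at the modulus `𝔪_M`);
* `eisensteinE_mul_eq_of_lattice_specs` — `E_n(σ(d)·z; Ω·σ(J)) = σ(d)^{−n}·E_n(z; Ω·σ(J/(d)))` (de Shalit II.3.3 (i) on hsum's lattices);
* `eq_or_eq_of_natCast_two_mem` — at a split `2 = v v̄` of a quadratic field the primes containing `2` are `v`, `v̄`;
* `thetaC_euler_datum` — the Euler datum `hW` of the seam identity read on `intToUnrCoeff`: `Θ(u)·Θ(u·2)^{m−1}·ι⁻¹(σ(α₀)^{−m})·ι⁻¹(w) = ι⁻¹(w/2)`;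
* ★ `avatarValueAt_ker_eq_padicIntCast_inv_pow` — for `ε` of type `(−m, 0)` with module of definition `≤ 𝔪`, `v ∤ 𝔪` of degree one the place of
  `ι⁻¹ ∘ σ_{w₀}`, and ANY relative avatar `e` of `ε` outside `S`: `ê(y) = cast(((e₂ κ_v)⁻¹ y)^m)` on `Gal(K̄/K(𝔪))` — A2
  (`AvatarOnRay.avatarValueAt_eq_padicIntCast_zpow_of_type`) through `IsPAdicAvatarOutside.isPAdicAvatarOf` (Chebotarev rigidity) and the
  rigidity `ringEquiv_eq_padicIntEquivOfDegreeOne` of `ℤ₂`, in the exact shape of the hypothesis `hχG` of H11 / the seam identity.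

## References
* [deShalit1987] E. de Shalit, *Iwasawa theory of elliptic curves with complex multiplication* (1987), II.3.3 (i), II.4.13 (p. 69), II.4.14 (36)–(38) (p. 71–73).
* [NeukirchANT1999] J. Neukirch, *Algebraic Number Theory* (1999), Ch. I §8 Prop. (8.3), Ch. VII §6 (6.11).
-/

-- the summit namespace `Summit.BirchSwinnertonDyer.BirchSwinnertonDyer` repeats the problem name by design (D-0017)
set_option linter.dupNamespace false
set_option autoImplicit false

noncomputable section

open scoped Classical nonZeroDivisors
open scoped NumberField
open NumberField Field IsDedekindDomain IsDedekindDomain.HeightOneSpectrum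
open Literature.NumberTheory.NumberFields
open Literature.NumberTheory.GaloisRepresentations Literature.NumberTheory.GaloisRepresentations.HeckeCharacter
open Literature.NumberTheory.EllipticCurves Literature.NumberTheory.EllipticCurves.DeShalit1987
open Literature.NumberTheory.LFunctions Literature.NumberTheory.PAdicHodge
open Literature.NumberTheory.GaloisRepresentations.IsNonarchimedeanLocalField Literature.NumberTheory.GaloisRepresentations.LubinTate ValuativeRel

namespace Summit.BirchSwinnertonDyer.BirchSwinnertonDyer.Theorems.PrintCf2.KatzMeasureJZeroSeam

/-- `ord_w 𝔪(T, e) = e(w) + 1 ≥ e(w)` for `w ∈ T` (the `hle` input of A2 at the modulus `𝔪_M`).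
[cite: NeukirchANT1999, Ch. VII §6, after Def. (6.11)] -/
theorem le_count_modulusIdeal {K : Type} [Field K] [NumberField K] (T : Finset (HeightOneSpectrum (𝓞 K)))
    (e : HeightOneSpectrum (𝓞 K) → ℕ) (w : HeightOneSpectrum (𝓞 K)) (hw : w ∈ T) :
    (e w : ℤ) ≤ FractionalIdeal.count K w ((modulusIdeal T e : Ideal (𝓞 K)) : FractionalIdeal (𝓞 K)⁰ K) := by
  classical
  unfold modulusIdeal
  have hne : ∀ w' ∈ T, ((w'.asIdeal ^ (e w' + 1) : Ideal (𝓞 K)) : FractionalIdeal (𝓞 K)⁰ K) ≠ 0 := fun w' _ ↦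
    FractionalIdeal.coeIdeal_ne_zero.mpr (pow_ne_zero _ w'.ne_bot)
  rw [← FractionalIdeal.coeIdealHom_apply, map_prod,
    FractionalIdeal.count_prod K w T (fun x ↦ FractionalIdeal.coeIdealHom (𝓞 K)⁰ K (x.asIdeal ^ (e x + 1))) (fun w' hw' ↦ by
      rw [FractionalIdeal.coeIdealHom_apply]; exact hne w' hw')]
  simp only [FractionalIdeal.coeIdealHom_apply, FractionalIdeal.coeIdeal_pow, FractionalIdeal.count_pow]
  rw [Finset.sum_eq_single_of_mem w hw (fun w' _ hw' ↦ by rw [FractionalIdeal.count_maximal_coprime K w hw', mul_zero]),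
    FractionalIdeal.count_self, mul_one]
  push_cast
  linarith

/-- **Homogeneity between class lattices** (de Shalit II.3.3 (i) `E_k(cz, cL) = c^{−k}E_k(z, L)` read on hsum's lattices): if
`Λ(L₁) = Ω·σ(J)` and `Λ(L₂) = Ω·σ(J/(d))` for a fractional ideal `J` and `d ≠ 0`, then `E_n(σ(d)·z; L₁) = σ(d)^{−n}·E_n(z; L₂)`.
[cite: deShalit1987, II.3.3 (i)] -/
theorem eisensteinE_mul_eq_of_lattice_specs {K : Type} [Field K] [NumberField K] (σ : K →+* ℂ) {Ω : ℂ}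
    (J : FractionalIdeal (𝓞 K)⁰ K) {d : 𝓞 K} (hd : d ≠ 0) {L₁ L₂ : PeriodPair}
    (h₁ : ∀ z : ℂ, z ∈ L₁.lattice ↔ ∃ y ∈ J, z = Ω * σ y)
    (h₂ : ∀ z : ℂ, z ∈ L₂.lattice ↔
      ∃ y ∈ J / ((Ideal.span {d} : Ideal (𝓞 K)) : FractionalIdeal (𝓞 K)⁰ K), z = Ω * σ y)
    (n : ℕ) (z : ℂ) :
    L₁.eisensteinE n (σ (d : K) * z) = ((σ (d : K)) ^ n)⁻¹ * L₂.eisensteinE n z := by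
  have hdK : (d : K) ≠ 0 := by exact_mod_cast hd
  have hc : σ (d : K) ≠ 0 := (map_ne_zero σ).mpr hdK
  have hc' : (σ (d : K))⁻¹ ≠ 0 := inv_ne_zero hc
  -- the second lattice is the first scaled by `c⁻¹`
  have hlat : L₂.lattice = (L₁.mulLeft (σ (d : K))⁻¹ hc').lattice := by
    ext w
    rw [h₂, PeriodPair.mem_mulLeft_lattice, inv_inv, h₁, FractionalIdeal.coeIdeal_span_singleton,
      FractionalIdeal.div_spanSingleton]
    constructor
    · rintro ⟨y, hy, rfl⟩
      obtain ⟨y', hy', rfl⟩ := FractionalIdeal.mem_singleton_mul.mp hy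
      refine ⟨y', hy', ?_⟩
      rw [map_mul, map_inv₀]
      change σ (d : K) * (Ω * ((σ (d : K))⁻¹ * σ y')) = Ω * σ y'
      field_simp
    · rintro ⟨y', hy', h⟩
      refine ⟨(algebraMap (𝓞 K) K d)⁻¹ * y', FractionalIdeal.mem_singleton_mul.mpr ⟨y', hy', rfl⟩, ?_⟩
      rw [map_mul, map_inv₀]
      change w = Ω * ((σ (d : K))⁻¹ * σ y')
      field_simp
      linear_combination h
  rw [PeriodPair.eisensteinE_eq_of_lattice_eq hlat, PeriodPair.eisensteinE_mulLeft' L₁ hc' n z, inv_pow, inv_inv,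
    div_inv_eq_mul, mul_comm z, ← mul_assoc, inv_mul_cancel₀ (pow_ne_zero n hc), one_mul]



/-- **The primes above `2` are `v` and `v̄`** at a split `(2) = v·v̄` of a quadratic field (`span_natCast_eq_mul_of_finrank_eq_two`).
[cite: NeukirchANT1999, Ch. I §8 Prop. (8.3)] -/
theorem eq_or_eq_of_natCast_two_mem {K : Type} [Field K] [NumberField K] (hK2 : Module.finrank ℚ K = 2) {v vbar : HeightOneSpectrum (𝓞 K)}
    (hv2 : ((2 : ℕ) : 𝓞 K) ∈ v.asIdeal) (hvbar2 : ((2 : ℕ) : 𝓞 K) ∈ vbar.asIdeal) (hne : vbar ≠ v) (w : HeightOneSpectrum (𝓞 K))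
    (hw2 : ((2 : ℕ) : 𝓞 K) ∈ w.asIdeal) : w = v ∨ w = vbar := by
  have hle2 : v.asIdeal * vbar.asIdeal ≤ w.asIdeal := by
    rw [← span_natCast_eq_mul_of_finrank_eq_two 2 hK2 Nat.prime_two hv2 hvbar2 hne, Ideal.span_singleton_le_iff_mem]; exact hw2
  rcases (w.isPrime.mul_le).mp hle2 with h | h
  · exact Or.inl (HeightOneSpectrum.ext (v.isMaximal.eq_of_le w.isPrime.ne_top h)).symm
  · exact Or.inr (HeightOneSpectrum.ext (vbar.isMaximal.eq_of_le w.isPrime.ne_top h)).symm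

/-- ★ **The EXACT avatar on `Gal(K̄/K(𝔪))` in the cell-sum currency** (`hχG` of H11): for `K` imaginary quadratic, `ε` of type `(−m, 0)` with module of
definition `(T, e) ≤ 𝔪`, `v ∤ 𝔪` of degree one above `2` and THE place of `ι⁻¹ ∘ σ_{w₀}`, `w_𝔪 = 1`, ANY `e₂ : 𝒪_v ≅ ℤ₂`, and ANY relative avatar `e` of
`ε` outside `S` (it is Weil's, `IsPAdicAvatarOutside.isPAdicAvatarOf`): `ê(y) = cast(((e₂ ∘ κ_v)⁻¹ y)^m)` for `y ∈ Gal(K̄/K(𝔪))`.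
[cite: deShalit1987, II.4.13 (p. 69), II.4.14 (36)–(38) (p. 71–73)] [cite: SerreAbelianLadic1968, Ch. II §2.7] -/
theorem avatarValueAt_ker_eq_padicIntCast_inv_pow {K : Type} [Field K] [NumberField K] [IsTotallyComplex K] (hK2 : Module.finrank ℚ K = 2)
    (ι : PadicAlgCl 2 ≃+* ℂ) (w₀ : InfinitePlace K) {v vbar : HeightOneSpectrum (𝓞 K)}
    (hv2 : ((2 : ℕ) : 𝓞 K) ∈ v.asIdeal) (hvbar2 : ((2 : ℕ) : 𝓞 K) ∈ vbar.asIdeal) (hne : vbar ≠ v)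
    (hιv : ∀ d : 𝓞 K, d ∈ v.asIdeal ↔ ‖ι.symm (w₀.embedding (d : K))‖ < 1)
    {𝔪 : Ideal (𝓞 K)} (h𝔪 : 𝔪 ≠ ⊥) (hv𝔪 : ¬ 𝔪 ≤ v.asIdeal) (hw𝔪 : ∀ u : (𝓞 K)ˣ, (u : 𝓞 K) - 1 ∈ 𝔪 → u = 1)
    (e₂ : v.adicCompletionIntegers K ≃+* ℤ_[2])
    {S : Finset (HeightOneSpectrum (𝓞 K))} {εH : HeckeCharacter K} {eH : FramedGaloisRep K (PadicAlgCl 2) 1} {m : ℕ}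
    (he : IsPAdicAvatarOutside S ι εH eH) (hεt : εH.HasInfinityType (fun _ ↦ -(m : ℤ)) (fun _ ↦ 0))
    {T : Finset (HeightOneSpectrum (𝓞 K))} {em : HeightOneSpectrum (𝓞 K) → ℕ} (hεmod : εH.IsModulus T em)
    (hle : ∀ w ∈ T, (em w : ℤ) ≤ FractionalIdeal.count K w (𝔪 : FractionalIdeal (𝓞 K)⁰ K))
    (y : ↥(absRestrictNormalHom (rayClassField K 𝔪)).ker) :
    avatarValueAt eH y = padicIntCast ℂ_[2] (((((Units.map (e₂ : v.adicCompletionIntegers K →+* ℤ_[2]).toMonoidHom).comp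
      (rayAdicCharacter h𝔪 hv𝔪 hw𝔪))⁻¹) y : ℤ_[2]) ^ m) := by
  haveI : v.asIdeal.LiesOver (ratPlace 2).asIdeal := liesOver_ratPlace_of_natCast_mem K v hv2
  obtain ⟨he1, hf1⟩ := ramificationIdx_eq_one_and_inertiaDeg_eq_one_of_natCast_mem_of_ne K hK2 hv2 hvbar2 hne
  have hw₀ : ∀ w : InfinitePlace K, w = w₀ := by
    haveI := subsingleton_infinitePlace_of_finrank_eq_two (K := K) hK2
    exact fun w ↦ Subsingleton.elim w w₀
  have hav : IsPAdicAvatarOf ι εH eH := he.isPAdicAvatarOf ((εH.isAlgebraic_iff_exists_hasInfinityType).mpr ⟨_, _, hεt⟩)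
  have hA2 := AvatarOnRay.avatarValueAt_eq_padicIntCast_zpow_of_type ι hεt hεmod hav hle h𝔪 hv𝔪 hw𝔪 he1 hf1 hv2 hw₀ rfl hιv y.2
  rw [hA2, zpow_neg, zpow_natCast, MonoidHom.inv_apply, map_pow, map_units_inv, inv_pow]
  congr 2
  rw [MonoidHom.comp_apply, RingHom.toMonoidHom_eq_coe, Units.coe_map, MonoidHom.coe_coe]
  exact congrArg _ (KatzMeasureJZeroTop.ringEquiv_eq_padicIntEquivOfDegreeOne he1 hf1 e₂ _).symm


/-- ★ **The Euler datum of the seam identity** (`hW` of `KatzMeasureJZeroSeam.twist_mul_integral_eq_of_perUnit`): with the lane's reading `j` of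
`𝒪_E` (`j ∘ ι_{LT} = intToUnrCoeff`), D1's `hΘe`, the uniformiser `u·2 = α₀ ∈ K` at the degree-one place `v` of `ι⁻¹ ∘ σ`:
`Θ(j u)·Θ(j(u·2))^{m−1}·ι⁻¹(σ(α₀)^{−m})·ι⁻¹(w) = ι⁻¹(w·2⁻¹)` — i.e. `u·π^{m−1}·ψ(𝔭)^{−m} = 1/2` read in `ℂ₂`.
[cite: deShalit1987, II.4.14 (38)–(40) (p. 71–72), II.4.7 (17) (p. 60)] -/
theorem thetaC_euler_datum {K : Type} [Field K] [NumberField K] (ι : PadicAlgCl 2 ≃+* ℂ) (σ : K →+* ℂ)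
    {v : HeightOneSpectrum (𝓞 K)} [v.asIdeal.LiesOver (ratPlace 2).asIdeal]
    (he : v.asIdeal.ramificationIdx (𝓞 ℚ) = 1) (hf : v.asIdeal.inertiaDeg (𝓞 ℚ) = 1)
    (hιv : ∀ d : 𝓞 K, d ∈ v.asIdeal ↔ ‖ι.symm (σ (d : K))‖ < 1)
    {α₀ : 𝓞 K} (hα₀ : α₀ ≠ 0) (u : 𝒪[v.adicCompletion K]ˣ)
    (hu : ((((u : 𝒪[v.adicCompletion K]) * ((2 : ℕ) : 𝒪[v.adicCompletion K]) : 𝒪[v.adicCompletion K]) : v.adicCompletion K)) =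
      ((α₀ : K) : v.adicCompletion K))
    (θ : CompletedAlgClosure (v.adicCompletion K) →+* ℂ_[2]) (e₂ : v.adicCompletionIntegers K ≃+* ℤ_[2])
    (hΘe : ∀ a : 𝒪[v.adicCompletion K], (θ.comp ((CBall (v.adicCompletion K)).subtype.comp
        (algebraMap (UnrCoeff (v.adicCompletion K)) (CBall (v.adicCompletion K))))) (intToUnrCoeff (v.adicCompletion K) a) =
      padicIntCast ℂ_[2] (((e₂ : v.adicCompletionIntegers K →+* ℤ_[2]).comp (integerEquivAdicCompletionIntegers v).toRingHom) a))
    {m : ℕ} (hm : 1 ≤ m) (w : ℂ) :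
    (θ.comp ((CBall (v.adicCompletion K)).subtype.comp
        (algebraMap (UnrCoeff (v.adicCompletion K)) (CBall (v.adicCompletion K)))))
        (intToUnrCoeff (v.adicCompletion K) (u : 𝒪[v.adicCompletion K])) *
      (θ.comp ((CBall (v.adicCompletion K)).subtype.comp
        (algebraMap (UnrCoeff (v.adicCompletion K)) (CBall (v.adicCompletion K)))))
        (intToUnrCoeff (v.adicCompletion K) ((u : 𝒪[v.adicCompletion K]) * ((2 : ℕ) : 𝒪[v.adicCompletion K]))) ^ (m - 1) *
      ((ι.symm (((σ ((α₀ : 𝓞 K) : K)) ^ m)⁻¹) : PadicAlgCl 2) : ℂ_[2]) * ((ι.symm w : PadicAlgCl 2) : ℂ_[2]) =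
      ((ι.symm (w * (((2 : ℕ) : ℂ))⁻¹) : PadicAlgCl 2) : ℂ_[2]) := by
  set τC : ℂ →+* ℂ_[2] := (algebraMap (PadicAlgCl 2) ℂ_[2]).comp ι.symm.toRingHom with hτC
  have hτapp : ∀ z : ℂ, ((ι.symm z : PadicAlgCl 2) : ℂ_[2]) = τC z := fun z ↦ rfl
  have hcα0 : σ ((α₀ : 𝓞 K) : K) ≠ 0 := (map_ne_zero _).mpr (by exact_mod_cast hα₀)
  have hTα : θ (algebraMap (v.adicCompletion K) (CompletedAlgClosure (v.adicCompletion K)) ((α₀ : K) : v.adicCompletion K)) =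
      τC (σ ((α₀ : 𝓞 K) : K)) := by
    rw [KatzMeasureJZeroTop.theta_algebraMap_eq he hf θ e₂ hΘe]
    have hc' := congrArg (fun φ : K →+* ℂ ↦ φ ((α₀ : 𝓞 K) : K)) (AvatarOnRay.comp_eq_of_place_eq (p := 2) ι he hf σ hιv)
    simp only [RingHom.comp_apply, RingEquiv.toRingHom_eq_coe, RingHom.coe_coe] at hc'
    rw [← hτapp, ← hc', RingEquiv.symm_apply_apply, ← IsScalarTower.algebraMap_apply]
    rfl
  have hT2 : θ (algebraMap (v.adicCompletion K) (CompletedAlgClosure (v.adicCompletion K))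
      ((((u : 𝒪[v.adicCompletion K]) * ((2 : ℕ) : 𝒪[v.adicCompletion K]) : 𝒪[v.adicCompletion K]) : v.adicCompletion K))) =
      τC (σ ((α₀ : 𝓞 K) : K)) := by rw [hu]; exact hTα
  have hθu2 : θ (algebraMap (v.adicCompletion K) (CompletedAlgClosure (v.adicCompletion K))
      ((u : 𝒪[v.adicCompletion K]) : v.adicCompletion K)) * 2 = τC (σ ((α₀ : 𝓞 K) : K)) := by
    rw [← hT2, MulMemClass.coe_mul, map_mul, map_mul, SubringClass.coe_natCast, map_natCast, map_natCast, Nat.cast_ofNat]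
  rw [thetaC_intToUnrCoeff, thetaC_intToUnrCoeff, hτapp, hτapp, hτapp, hT2]
  simp only [map_mul, map_inv₀, map_pow, Nat.cast_ofNat]
  have h2ne : (2 : ℂ_[2]) ≠ 0 := two_ne_zero
  have hTα0 : τC (σ ((α₀ : 𝓞 K) : K)) ≠ 0 := (map_ne_zero τC).mpr hcα0
  have hθu : θ (algebraMap (v.adicCompletion K) (CompletedAlgClosure (v.adicCompletion K))
      ((u : 𝒪[v.adicCompletion K]) : v.adicCompletion K)) = τC (σ ((α₀ : 𝓞 K) : K)) / 2 := by
    rw [eq_div_iff h2ne, hθu2]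
  have hm1 : m - 1 + 1 = m := Nat.sub_add_cancel hm
  have hcm : (τC (σ ((α₀ : 𝓞 K) : K))) ^ m = τC (σ ((α₀ : 𝓞 K) : K)) * (τC (σ ((α₀ : 𝓞 K) : K))) ^ (m - 1) := by
    conv_lhs => rw [← hm1, pow_succ']
  rw [hθu, hcm]
  field_simp
  rw [map_ofNat]
  ring

end Summit.BirchSwinnertonDyer.BirchSwinnertonDyer.Theorems.PrintCf2.KatzMeasureJZeroSeam

end
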